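import Literature.MathematicalPhysics.QuantumFieldTheory.BalabanImbrieJaffe1984to88.BIJ88LocWeights227Torus
import Literature.MathematicalPhysics.QuantumFieldTheory.BalabanImbrieJaffe1984to88.BIJ85Ineq722Torus
import Literature.MathematicalPhysics.QuantumFieldTheory.Balaban1983to89.B3Bound323ZeroTorus

/-!
# `BalabanImbrieJaffe1984to88.BIJ88LocDeriv230FlatTorus` — T. Bałaban, J. Imbrie, A. Jaffe, *Effective action and cluster properties of
the abelian Higgs model*, Commun. Math. Phys. **114** (1988) 257–315 [BalabanImbrieJaffe1988], Sect. 2 p. 263 [PDF 7], the sentence after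
(2.33): *"Bounds analogous to (2.30), (2.31) hold for covariant derivatives and Hölder derivatives of G_{k,loc}(u) of order less than two"* —
**THE COVARIANT-DERIVATIVE MEMBER OF (2.30) AT EVERY PURE-GAUGE BACKGROUND `u = 1^h` FOR THE PRINTED LOCALIZATION DATA** (the torus cubes
`{□_α}`, the weights `λ_α` of (2.27) and the cut-off `ζ″` of (2.29) of gen 26's `BIJ88LocWeights227Torus`): the operator
`f ↦ D^ε_{1^h}(G_{k,loc}(1^h)f)` obeys the (2.30)-type bound `(L^kε)·C·e^{−δ₀ dist(suppt f, x)/L^k}‖f‖_∞` on every bond deep inside `Ω₀`.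

statement-level skeleton of published theorems with citation tags; proofs where landed; nothing here is a claim about the Yang–Mills mass gap

PDF held: `paper:balaban1988-cmp114-bij-abelian-higgs-effective-action` (journal page = PDF page + 256); p. 263 [PDF 7] re-read this session
from the text layer (`lit read … --pages 7-8`).

CITATION HEADER (lean-in-tree rule).  Part of the lit-balaban TYPED SKELETON (HOME `run/shared/lean/pub/lit-balaban/`), PHASE-2 proof seat
p29 gen 27 (unit `lit-balaban-p29-g27`; TAKING line HOME/STATUS.md 2026-08-22T19:37:30Z; free-target protocol G.5-34(d) — the owner's `C2S14-CLOSURE.md` §5 item 2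
remainder *"derivative/Hölder members of G_{k,loc} itself"*).  Rows **C2.Eq2.30** / **C2.Eq2.31** second clause (owner r18; the abstract
hence-step for this sentence is p08's `BIJ88HolderDecay230`, real kernels with a DISPLAYED Lipschitz hypothesis; the value members for the data
are gen 26/27's `BIJ88LocWeights227Torus`; [6]'s derivative member for the torus CUBE propagators is p31's
`BIJ88DeltaLocFlatClose235.decay110_flat_cube_deriv_level`).  This file supplies the DERIVATIVE MEMBER FOR `G_{k,loc}` ITSELF, for the data.
Kind: theorems only (no definition, no `Prop`-valued fact; nothing restated — p31's/p13's/gen 26's declarations used BY NAME).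

THE PRINTED TEXT (verbatim, p. 263).  *"The boundary conditions are always at a distance O(r(e_k)) from x₁, x₂, so a straightforward application
of the random walk expansion of [6] shows that |(G_{k,loc}(u)f)(x)| ≦ ce^{−c dist(suppt f,x)}‖f‖_∞, (2.30) … for dist(x,Ω^c) ≧ O(r(e_k)). …
Bounds analogous to (2.30), (2.31) hold for covariant derivatives and Holder derivatives of G_{k,loc}(u) of order less than two."*  [6] =
[Balaban1983RegularityDecay] (1.10): the `|D^η_{u}G f|` member.

THE MECHANISM (ours, declared; the printed sentence gives none beyond *"analogous"*).  With the row sources `g_{x,α}(y) = ζ″(x,y)λ_α(x,y)f(y)`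
of p31's `gLocT_mulVec_apply` (`(G_{k,loc}f)(x) = Σ_α (G_k(□_α)g_{x,α})(x)`), on the bond `b = ⟨x, x+e_μ⟩`:
`D^ε_u(G_{k,loc}f)(b) = Σ_α D^ε_u(G_k(□_α)g_{x+e_μ,α})(b) + Σ_α ε⁻¹(G_k(□_α)(g_{x+e_μ,α} − g_{x,α}))(x)` (`covD_gLocT_apply`).  The first sum is
[6]'s covariant-derivative member for the cubes ACTIVE at `x+e_μ` (p31's `decay110_flat_cube_deriv_level`; both endpoints lie in every active
cube by gen 26's row hypothesis (ii) once `R > 1`), the second is [6]'s value member (p31's `decay110_flat_cube_level`) on the DIFFERENCE source,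
whose sup is `≤ (K_σ/(R₀−R₁) + 3π(d+1)/(2s))‖f‖_∞` by the Lipschitz continuity of the cut-off profile in the torus distance (§1: `σ` =
`Real.smoothTransition` is globally Lipschitz — continuous derivative on the compact `[0,1]`, constant outside; one lattice step moves the sup
torus distance by `≤ 1`) and of p13's chart weights in the midpoint (`abs_cwt_sub_le`, *"varies smoothly with (x₁+x₂)/2"*; one lattice step
inside `Ω₀` moves the chart midpoint-sum by a unit vector).  The multiplicity of either sum is gen 26's block count
`m = (⌊(L^k − 1 + R₀)/s⌋ + 3)^{d+1}`, and `ε⁻¹(L^kε)² = (L^kε)·L^k` converts the value member to the derivative scale.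

WHAT IS PROVED (theorems only; 0 `sorry`; standard axioms).
* §1 `exists_abs_cutoff_sub_le` (p13's cut-off of (2.29) is `K_σ/(R₀−R₁)`-Lipschitz in the distance, `K_σ` universal), `T_shift_le_one` /
  `abs_T_shift_sub_le` (one lattice step vs the sup torus distance), `boxCoord_shift` (chart coordinates of a unit step inside the box),
  `abs_lamT_shift_sub_le` (the weights of (2.27) move by `≤ 3π(d+1)/(2s)` under a unit step of the output point inside `Ω₀`),
  `norm_rowSource_sub_le` (the difference source is `≤ (K_σ/(R₀−R₁) + 3π(d+1)/(2s))·‖f‖_∞`).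
* §2 `covD_gLocT_apply` (the bond identity above, any background, any data).
* §3 **`deriv230_flat_cwt`** — THERE EXIST `δ₀, c₀ > 0` depending on `(d, ℓ, a)` only such that for every volume, every `1 ≤ k ≤ K`, every
  no-wrap box `Ω₀` shorter than the torus leaving a torus gap `≥ R`, cube spacing `s ≥ 1`, half-width `W ≥ 2s/3 + R₀/2 + R`, radii `1 < R`,
  `0 ≤ R₁ < R₀`, every pure gauge `h`, every bond `⟨x, x+e_μ⟩` with BOTH endpoints in `Ω₀` at chart depth `≥ R₀` (print's *"dist(x,Ω^c) ≧
  O(r(e_k))"*), and every `f` with `‖f‖_∞ ≤ F` supported at sup-torus distance `≥ D ≥ 0` from `x`: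
  `‖D^ε_{1^h}(G_{k,loc}(1^h)f)(⟨x, x+e_μ⟩)‖ ≤ (L^kε)·c₀·m·(1 + L^k·((R₀ − R₁)⁻¹ + s⁻¹))·e^{−δ₀D/L^k}·F`, `m = (⌊(L^k − 1 + R₀)/s⌋ + 3)^{d+1}` —
  at the printed radii (`s`, `R₀ − R₁ ~ r(e_{k−1})L^k ≫ L^k`) the bracket is `O(1)`: the printed *"bounds analogous to (2.30) … for covariant
  derivatives"* of `G_{k,loc}` at flat `u`, for the printed localization, in [6]'s scale `(L^kε)` of the derivative member.
HONEST SCOPE.  (i) FLAT / PURE-GAUGE BACKGROUNDS ONLY (the (2.32)-smooth case is XL, p31's (i)).  (ii) The (2.30)-ANALOGUE ONLY: the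
(2.31)-analogue for derivatives (closeness of `D G_{k,loc}` to `D G_k(Ω₀)`) and the HÖLDER quotients are NOT here (the Hölder member follows
from a kernel Lipschitz bound by p08's `holderOpDecay230` for real kernels; not instantiated).  (iii) Both endpoints of the bond at chart depth
`≥ R₀` in the no-wrap box `Ω₀` (gen 26 (b), (c)), `R > 1` so that a unit step stays inside every active cube.  (iv) The constant carries the
explicit factor `1 + L^k((R₀−R₁)⁻¹ + s⁻¹)` instead of print's unspecified `c` (an honest dependence on the free radii; `O(1)` at the printed
ones); `K_σ` is a bound on `|σ′|` over `[0,1]` obtained by compactness, not computed.  (v) `j = 0`, window `a₋ = a₊ = a`, constants not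
optimized; Lipschitz profile of p13 for `λ_α` (gen 26 (e)).
Imports: gen 26 `BIJ88LocWeights227Torus` (→ p31 `BIJ88DeltaLocFlatClose235` → `…FlatClose231`, `…FlatDecayCube`; p13 `BIJ88ConvexWeights227`,
`BIJ88Cutoffs21`), p11 `BIJ85Ineq722Torus` (`supDist_runSite_le`), p39 `B3Bound323ZeroTorus` (`T_eq_supDist`).  Literature + Mathlib only.
Unit `lit-balaban-p29` (literature-prover-lit-balaban-p29-g27-0), 2026-08-22.  NOT summit progress.
-/

open scoped BigOperators Matrix ComplexConjugate
open Finset Matrix Set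

namespace Literature.MathematicalPhysics.QuantumFieldTheory.BalabanImbrieJaffe1984to88.BIJ88LocDeriv230FlatTorus

open Literature.MathematicalPhysics.QuantumFieldTheory.Balaban1983to89
open BIJ88Sect3Statements (U1 toC cfg covD)
open BIJ85BlockAveragesTorus BIJ85BlockAveragesTorusK
open BIJ88NeumannPropagator227Torus (gBox)
open BIJ88DeltaLoc234Torus (gLocT)
open BIJ88NeumannPropagatorFlatDecayCube
open BIJ88NeumannPropagatorFlatClose231 (gLocT_mulVec_apply norm_rowSource_le rowSource_ne_zero abs_lam_le_one)
open BIJ88DeltaLocFlatClose235 (decay110_flat_cube_level decay110_flat_cube_deriv_level)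
open BIJ88ConvexWeights227 (cwt abs_cwt_sub_le)
open BIJ88Cutoffs21 (cutoff cutoff_nonneg cutoff_le_one)
open BIJ88LocWeights227Torus
open B4Reflection242 (boxDom mem_boxDom)
open GaugeField (gaugeAct)

noncomputable section

variable {d : ℕ} {P : Params}

/-! ## §1 Lipschitz continuity of the data under one lattice step of the output point -/

section Lipschitz

/-- kernel: **the profile `σ = Real.smoothTransition` is globally Lipschitz**: `|σ(u) − σ(u′)| ≤ K|u − u′|` for some `K ≥ 0` (the derivative is
continuous on the compact `[0, 1]`, and `σ ∘ proj_{[0,1]} = σ`). [folklore] -/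
private theorem exists_lipschitz_smoothTransition :
    ∃ K : ℝ, 0 ≤ K ∧ ∀ u u' : ℝ, |Real.smoothTransition u - Real.smoothTransition u'| ≤ K * |u - u'| := by
  have hcd : ContDiff ℝ 1 Real.smoothTransition := Real.smoothTransition.contDiff
  have hdiff : Differentiable ℝ Real.smoothTransition := hcd.differentiable one_ne_zero
  have hcont : Continuous (deriv Real.smoothTransition) := hcd.continuous_deriv le_rfl
  obtain ⟨K, hK⟩ := isCompact_Icc.exists_bound_of_continuousOn (hcont.continuousOn (s := Icc (0 : ℝ) 1))
  have hK0 : 0 ≤ K := (norm_nonneg _).trans (hK 0 (left_mem_Icc.2 zero_le_one))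
  have hKc : ((K.toNNReal : NNReal) : ℝ) = K := Real.coe_toNNReal K hK0
  have hon : LipschitzOnWith K.toNNReal Real.smoothTransition (Icc (0 : ℝ) 1) :=
    (convex_Icc (0 : ℝ) 1).lipschitzOnWith_of_nnnorm_deriv_le (fun x _ => hdiff.differentiableAt) fun x hx => by
      have := hK x hx
      rw [← NNReal.coe_le_coe, coe_nnnorm, hKc]
      exact this
  refine ⟨K, hK0, fun u u' => ?_⟩
  rw [← Real.smoothTransition.projIcc (x := u), ← Real.smoothTransition.projIcc (x := u')]
  have h1 := hon.dist_le_mul (projIcc (0 : ℝ) 1 zero_le_one u) (projIcc 0 1 zero_le_one u).2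
    (projIcc (0 : ℝ) 1 zero_le_one u') (projIcc 0 1 zero_le_one u').2
  rw [Real.dist_eq, Real.dist_eq, hKc] at h1
  have h2 : |((projIcc (0 : ℝ) 1 zero_le_one u : ℝ)) - (projIcc (0 : ℝ) 1 zero_le_one u' : ℝ)| ≤ |u - u'| :=
    abs_projIcc_sub_projIcc zero_le_one
  exact h1.trans (mul_le_mul_of_nonneg_left h2 hK0)

/-- **The cut-off of (2.29) is Lipschitz in the distance**: there is a universal `K_σ ≥ 0` with
`|ζ″(a,b) − ζ″(a′,b′)| ≤ (K_σ/(R₀ − R₁))·|dist(a,b) − dist(a′,b′)|` for p13's `cutoff R₁ R₀ dist` (`ζ″ = σ((R₀ − dist)/(R₀ − R₁))`, *"ζ″_k(x₁,x₂)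
is a smooth function of x₁ − x₂"*). [cite: BalabanImbrieJaffe1988, (2.29) p.263] -/
theorem exists_abs_cutoff_sub_le : ∃ K : ℝ, 0 ≤ K ∧ ∀ (R₁ R₀ : ℝ), R₁ < R₀ →
    ∀ {α β : Type*} (dist : α → β → ℝ) (a : α) (b : β) (a' : α) (b' : β),
      |cutoff R₁ R₀ dist a b - cutoff R₁ R₀ dist a' b'| ≤ K / (R₀ - R₁) * |dist a b - dist a' b'| := by
  obtain ⟨K, hK0, hK⟩ := exists_lipschitz_smoothTransition
  refine ⟨K, hK0, fun R₁ R₀ hR α β dist a b a' b' => ?_⟩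
  have hgap : 0 < R₀ - R₁ := sub_pos.2 hR
  rw [BIJ88Cutoffs21.cutoff_apply, BIJ88Cutoffs21.cutoff_apply]
  refine (hK _ _).trans ?_
  rw [← sub_div, abs_div, abs_of_pos hgap, show R₀ - dist a b - (R₀ - dist a' b') = -(dist a b - dist a' b') by ring, abs_neg]
  exact le_of_eq (by field_simp)

/-- kernel: **one lattice step has sup-torus length `≤ 1`**: `|x − (x + e_μ)|_T ≤ 1` (`B5Ineq137Torus.T` = `LatticeFieldCalculus.supDist` by p39's
`T_eq_supDist`; p11's `supDist_runSite_le`). [cite: Balaban1982Higgs1, (1.3) p.604, dictionary] -/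
theorem T_shift_le_one {j : ℕ} (x : Balaban1983to89.Site P j) (μ : Fin P.d) : B5Ineq137Torus.T P j x (x.shift μ) ≤ 1 := by
  rw [B3Bound323ZeroTorus.T_eq_supDist]
  have h := BIJ85Ineq722Torus.supDist_runSite_le x μ 1
  have e : LatticeFieldCalculus.runSite x μ 1 = x.shift μ := by
    simp [LatticeFieldCalculus.runSite, Balaban1983to89.Site.shift]
  rw [e] at h
  exact_mod_cast h

/-- kernel: **the sup torus distance to any point moves by `≤ 1` under one lattice step**: `||x + e_μ − y|_T − |x − y|_T| ≤ 1` (triangle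
inequality). [cite: Balaban1982Higgs1, (1.3) p.604, dictionary] -/
theorem abs_T_shift_sub_le {j : ℕ} (x y : Balaban1983to89.Site P j) (μ : Fin P.d) :
    |B5Ineq137Torus.T P j (x.shift μ) y - B5Ineq137Torus.T P j x y| ≤ 1 := by
  have h1 := B5Ineq137Torus.T_triangle P j (x.shift μ) x y
  have h2 := B5Ineq137Torus.T_triangle P j x (x.shift μ) y
  have h3 := T_shift_le_one x μ
  rw [B5Ineq137Torus.T_symm P j (x.shift μ) x] at h1
  rw [abs_le]; constructor <;> linarith

variable (hPd : P.d = d + 1) {n : ℕ} {c N : Fin (d + 1) → ℕ}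

/-- kernel: `Fin.cast` round trip. [folklore] -/
private theorem cast_cast' (μ : Fin P.d) : Fin.cast hPd.symm (Fin.cast hPd μ) = μ := by
  ext; rfl

/-- kernel: **the chart coordinates of a unit step inside the cube**: `z(x + e_μ) = z(x) + e_i` when both `x` and `x + e_μ` lie in the no-wrap
cube `□ = c·n + Π_i[0, N_i)` (shorter than the torus). [cite: Balaban1983RegularityDecay, p.572, dictionary] -/
theorem boxCoord_shift (hfit : ∀ i, c i * n + N i ≤ P.sitesPerDir 0) (hN : ∀ i, N i < P.sitesPerDir 0)
    {x : Balaban1983to89.Site P 0} (hx : x ∈ cubeT hPd n c N) {μ : Fin P.d} (hxe : x.shift μ ∈ cubeT hPd n c N) :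
    boxCoord hPd n c (x.shift μ) = boxCoord hPd n c x + Pi.single (Fin.cast hPd μ) 1 := by
  obtain ⟨hz, hxz⟩ := cubePt_boxCoord hPd hfit hx
  set z := boxCoord hPd n c x with hzdef
  have hze : z + Pi.single (Fin.cast hPd μ) 1 ∈ boxDom N := (shift_cubePt_mem_iff hPd hN hz μ).1 (by rw [hxz]; exact hxe)
  have e : x.shift μ = cubePt hPd n c (z + Pi.single (Fin.cast hPd μ) 1) := by
    rw [cubePt_add_single, cast_cast', hxz]
  rw [e, boxCoord_cubePt hPd hfit hze]

/-- kernel: two integer vectors differing by a unit vector are at sup distance `≤ 1`. [folklore] -/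
private theorem dist_add_single_add_le (z w : Fin (d + 1) → ℤ) (i : Fin (d + 1)) :
    dist (z + Pi.single i 1 + w) (z + w) ≤ 1 := by
  refine (dist_pi_le_iff zero_le_one).2 fun j => ?_
  rw [Int.dist_eq]
  simp only [Pi.add_apply]
  by_cases hj : j = i
  · subst hj; rw [Pi.single_eq_same]; push_cast; rw [show ((z j : ℝ) + 1 + w j - (z j + w j)) = 1 by ring]; simp
  · rw [Pi.single_eq_of_ne hj]; simp

variable {M0 : Fin (d + 1) → ℕ} {s : ℕ}

/-- **The weights of (2.27) under one lattice step of the output point** (*"The convex combination varies smoothly with (x₁ + x₂)/2"*, p. 263;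
p13's `abs_cwt_sub_le`): for `x`, `x + e_μ ∈ Ω₀`, `|λ_α(x + e_μ, y) − λ_α(x, y)| ≤ 3π(d+1)/(2s)` (cube spacing `s ≥ 1`; the chart midpoint-sum
moves by a unit vector; outside `Ω₀` in `y` both weights vanish). [cite: BalabanImbrieJaffe1988, (2.27) p.263] -/
theorem abs_lamT_shift_sub_le (hs : 0 < s) (hfit : ∀ i, c i * n + n * M0 i ≤ P.sitesPerDir 0) (hN : ∀ i, n * M0 i < P.sitesPerDir 0)
    (α : Fin (d + 1) → ℤ) {x : Balaban1983to89.Site P 0} (hx : x ∈ cubeT hPd n c fun i => n * M0 i) {μ : Fin P.d}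
    (hxe : x.shift μ ∈ cubeT hPd n c fun i => n * M0 i) (y : Balaban1983to89.Site P 0) :
    |lamT hPd n c M0 s α (x.shift μ) y - lamT hPd n c M0 s α x y| ≤ 3 * Real.pi * (d + 1 : ℕ) / (2 * s) := by
  have hC : 0 ≤ 3 * Real.pi * (d + 1 : ℕ) / (2 * s) := by positivity
  by_cases hy : y ∈ cubeT hPd n c fun i => n * M0 i
  · rw [lamT_of_mem α hxe hy, lamT_of_mem α hx hy, boxCoord_shift hPd hfit hN hx hxe]
    refine (abs_cwt_sub_le hs α _ _ _ _).trans ?_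
    refine (mul_le_mul_of_nonneg_left (dist_add_single_add_le _ _ _) hC).trans ?_
    rw [mul_one]
  · rw [lamT_of_not α (fun h => hy h.2), lamT_of_not α (fun h => hy h.2), sub_zero, abs_zero]
    exact hC

/-- **The difference of the row sources of two neighbouring output points** (the sources `g_{x,α}(y) = ζ″(x,y)λ_α(x,y)f(y)` of p31's
`gLocT_mulVec_apply`): for `x`, `x + e_μ ∈ Ω₀`, a cut-off `ζ″ = cutoff R₁ R₀ |·|_T` with Lipschitz modulus `K/(R₀ − R₁)` in the distance, and
`‖f‖_∞ ≤ F`: `‖g_{x+e_μ,α}(y) − g_{x,α}(y)‖ ≤ (K/(R₀ − R₁) + 3π(d+1)/(2s))·F`. [cite: BalabanImbrieJaffe1988, (2.28) p.263] -/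
theorem norm_rowSource_sub_le (hs : 0 < s) (hfit : ∀ i, c i * n + n * M0 i ≤ P.sitesPerDir 0) (hN : ∀ i, n * M0 i < P.sitesPerDir 0)
    {K R₀ R₁ : ℝ} (hK0 : 0 ≤ K) (hR10 : R₁ < R₀)
    (hK : ∀ (a b a' b' : Balaban1983to89.Site P 0), |cutoff R₁ R₀ (B5Ineq137Torus.T P 0) a b - cutoff R₁ R₀ (B5Ineq137Torus.T P 0) a' b'| ≤
      K / (R₀ - R₁) * |B5Ineq137Torus.T P 0 a b - B5Ineq137Torus.T P 0 a' b'|)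
    (α : Fin (d + 1) → ℤ) {x : Balaban1983to89.Site P 0} (hx : x ∈ cubeT hPd n c fun i => n * M0 i) {μ : Fin P.d}
    (hxe : x.shift μ ∈ cubeT hPd n c fun i => n * M0 i) {f : Balaban1983to89.Site P 0 → ℂ} {F : ℝ} (hF : ∀ y, ‖f y‖ ≤ F)
    (y : Balaban1983to89.Site P 0) :
    ‖((cutoff R₁ R₀ (B5Ineq137Torus.T P 0) (x.shift μ) y : ℂ) * (lamT hPd n c M0 s α (x.shift μ) y : ℂ) -
        (cutoff R₁ R₀ (B5Ineq137Torus.T P 0) x y : ℂ) * (lamT hPd n c M0 s α x y : ℂ)) * f y‖ ≤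
      (K / (R₀ - R₁) + 3 * Real.pi * (d + 1 : ℕ) / (2 * s)) * F := by
  have hF0 : 0 ≤ F := (norm_nonneg _).trans (hF y)
  have hgap : 0 < R₀ - R₁ := sub_pos.2 hR10
  set ζ' := cutoff R₁ R₀ (B5Ineq137Torus.T P 0) (x.shift μ) y with hζ'def
  set ζ := cutoff R₁ R₀ (B5Ineq137Torus.T P 0) x y with hζdef
  set l' := lamT hPd n c M0 s α (x.shift μ) y with hl'def
  set l := lamT hPd n c M0 s α x y with hldef
  -- the real difference `ζ′l′ − ζl = (ζ′ − ζ)l′ + ζ(l′ − l)`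
  have hζ1 : |ζ' - ζ| ≤ K / (R₀ - R₁) := by
    refine (hK _ _ _ _).trans ?_
    calc K / (R₀ - R₁) * |B5Ineq137Torus.T P 0 (x.shift μ) y - B5Ineq137Torus.T P 0 x y| ≤ K / (R₀ - R₁) * 1 :=
          mul_le_mul_of_nonneg_left (abs_T_shift_sub_le x y μ) (by positivity)
      _ = K / (R₀ - R₁) := mul_one _
  have hl1 : |l' - l| ≤ 3 * Real.pi * (d + 1 : ℕ) / (2 * s) := abs_lamT_shift_sub_le hPd hs hfit hN α hx hxe y
  have hl'1 : |l'| ≤ 1 := by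
    rw [hl'def, abs_of_nonneg (lamT_nonneg _ _ _)]
    by_cases hy : y ∈ cubeT hPd n c fun i => n * M0 i
    · rw [lamT_of_mem α hxe hy]; exact BIJ88ConvexWeights227.cwt_le_one _ _ _ _
    · rw [lamT_of_not α (fun h => hy h.2)]; exact zero_le_one
  have hζ01 : |ζ| ≤ 1 := by rw [hζdef, abs_of_nonneg (cutoff_nonneg _ _ _ _ _)]; exact cutoff_le_one _ _ _ _ _
  have hreal : |ζ' * l' - ζ * l| ≤ K / (R₀ - R₁) + 3 * Real.pi * (d + 1 : ℕ) / (2 * s) := by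
    have e : ζ' * l' - ζ * l = (ζ' - ζ) * l' + ζ * (l' - l) := by ring
    rw [e]
    refine (abs_add_le _ _).trans ?_
    rw [abs_mul, abs_mul]
    have h1 : |ζ' - ζ| * |l'| ≤ K / (R₀ - R₁) := by
      calc |ζ' - ζ| * |l'| ≤ K / (R₀ - R₁) * 1 := mul_le_mul hζ1 hl'1 (abs_nonneg _) (by positivity)
        _ = _ := mul_one _
    have h2 : |ζ| * |l' - l| ≤ 3 * Real.pi * (d + 1 : ℕ) / (2 * s) := by
      calc |ζ| * |l' - l| ≤ 1 * (3 * Real.pi * (d + 1 : ℕ) / (2 * s)) := mul_le_mul hζ01 hl1 (abs_nonneg _) zero_le_one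
        _ = _ := one_mul _
    exact add_le_add h1 h2
  have hcast : ((ζ' : ℂ) * (l' : ℂ) - (ζ : ℂ) * (l : ℂ)) = ((ζ' * l' - ζ * l : ℝ) : ℂ) := by push_cast; ring
  rw [hcast, norm_mul, Complex.norm_real, Real.norm_eq_abs]
  exact mul_le_mul hreal (hF y) (norm_nonneg _) (by positivity)

end Lipschitz

/-! ## §2 The bond identity: the covariant derivative of `G_{k,loc}f` cube by cube -/

section Identity

/-- **`D^ε_u(G_{k,loc}f)(b) = Σ_α D^ε_u(G_k(□_α)g_{b₊,α})(b) + Σ_α ε⁻¹(G_k(□_α)(g_{b₊,α} − g_{b₋,α}))(b₋)`** with the row sources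
`g_{x,α}(y) = ζ″(x,y)λ_α(x,y)f(y)` — any background, any data (p31's `gLocT_mulVec_apply` at both endpoints, regrouped).
[cite: BalabanImbrieJaffe1988, (2.28) p.263] -/
theorem covD_gLocT_apply {j : ℕ} (c' : ℝ) (u : PBond P j → ℂ) (a' c'' : ℝ) (U : GaugeField P j U1) (k : ℕ) {ι : Type*} [Fintype ι]
    (cube : ι → Finset (Balaban1983to89.Site P j)) (lam : ι → Balaban1983to89.Site P j → Balaban1983to89.Site P j → ℝ)
    (ζ'' : Balaban1983to89.Site P j → Balaban1983to89.Site P j → ℝ) (f : Balaban1983to89.Site P j → ℂ) (b : PBond P j) :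
    covD c' u (gLocT a' c'' U k cube lam ζ'' *ᵥ f) b =
      ∑ α, covD c' u (gBox a' c'' U k (cube α) *ᵥ fun y => (ζ'' b.tgt y : ℂ) * (lam α b.tgt y : ℂ) * f y) b +
      ∑ α, (c' : ℂ) * (gBox a' c'' U k (cube α) *ᵥ fun y =>
          ((ζ'' b.tgt y : ℂ) * (lam α b.tgt y : ℂ) - (ζ'' b.src y : ℂ) * (lam α b.src y : ℂ)) * f y) b.src := by
  have hsplit : ∀ α, (gBox a' c'' U k (cube α) *ᵥ fun y =>
      ((ζ'' b.tgt y : ℂ) * (lam α b.tgt y : ℂ) - (ζ'' b.src y : ℂ) * (lam α b.src y : ℂ)) * f y) b.src =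
        (gBox a' c'' U k (cube α) *ᵥ fun y => (ζ'' b.tgt y : ℂ) * (lam α b.tgt y : ℂ) * f y) b.src -
        (gBox a' c'' U k (cube α) *ᵥ fun y => (ζ'' b.src y : ℂ) * (lam α b.src y : ℂ) * f y) b.src := by
    intro α
    have e : (fun y => ((ζ'' b.tgt y : ℂ) * (lam α b.tgt y : ℂ) - (ζ'' b.src y : ℂ) * (lam α b.src y : ℂ)) * f y) =
        (fun y => (ζ'' b.tgt y : ℂ) * (lam α b.tgt y : ℂ) * f y) - fun y => (ζ'' b.src y : ℂ) * (lam α b.src y : ℂ) * f y := by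
      funext y; simp only [Pi.sub_apply]; ring
    rw [e, Matrix.mulVec_sub, Pi.sub_apply]
  simp only [covD, hsplit]
  rw [gLocT_mulVec_apply, gLocT_mulVec_apply, Finset.mul_sum, ← Finset.sum_sub_distrib, Finset.mul_sum, ← Finset.sum_add_distrib]
  exact Finset.sum_congr rfl fun α _ => by ring

end Identity

/-! ## §3 The covariant-derivative member of (2.30) at flat backgrounds FOR THE PRINTED DATA -/

section Deriv

/-- kernel: the label of a fine site over its own `k`-block site. [cite: BalabanImbrieJaffe1985, (2.4) p.302, dictionary] -/
private theorem mem_blockK_blkIter {k : ℕ} (x : Balaban1983to89.Site P 0) : x ∈ blockK k (blkIter k x) :=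
  mem_blockK.2 rfl

/-- **THE COVARIANT-DERIVATIVE MEMBER OF (2.30) AT EVERY PURE-GAUGE BACKGROUND `u = 1^h`, FOR THE PRINTED LOCALIZATION DATA** (p. 263:
*"Bounds analogous to (2.30), (2.31) hold for covariant derivatives and Holder derivatives of G_{k,loc}(u) of order less than two"*, the
(2.30)-analogue for the covariant derivative).  THERE EXIST `δ₀, c₀ > 0` depending on `(d, ℓ, a)` only such that for every volume
(`P.d = d+1`, `P.L = ℓ+1`), every `1 ≤ k ≤ K`, every no-wrap box `Ω₀ = c·L^k + Π_i[0, L^k·M₀_i)` shorter than the torus and leaving a torus gap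
`≥ R`, every cube spacing `s ≥ 1` and half-width `W ≥ 2s/3 + R₀/2 + R`, radii `1 < R`, `0 ≤ R₁ < R₀`, every pure gauge `h`, every bond
`⟨x, x + e_μ⟩` of the fine torus with both endpoints in `Ω₀` at chart depth `≥ R₀`, and every source `f` with `‖f‖_∞ ≤ F` supported at
sup-torus distance `≥ D ≥ 0` from `x`:
`‖ε⁻¹(u(b)(G_{k,loc}(1^h)f)(x + e_μ) − (G_{k,loc}(1^h)f)(x))‖ ≤ (L^kε)·c₀·m·(1 + L^k·((R₀ − R₁)⁻¹ + s⁻¹))·e^{−δ₀D/L^k}·F`,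
`m = (⌊(L^k − 1 + R₀)/s⌋ + 3)^{d+1}`, `u(b) = h(x)h(x + e_μ)^{−1}`, where `G_{k,loc}(1^h)` is built from the torus cubes `{□_α}`, the weights
`λ_α` of (2.27) and the cut-off `ζ″` of (2.29) of gen 26 — [6]'s derivative member (scale `(L^kε)`, p31's `decay110_flat_cube_deriv_level`)
for the cubes active at `x + e_μ`, plus [6]'s value member on the difference sources (Lipschitz data, §1), times `ε⁻¹(L^kε)² = (L^kε)L^k`.
[cite: BalabanImbrieJaffe1988, (2.30) p.263] -/
theorem deriv230_flat_cwt (d ℓ : ℕ) (hℓ : 1 ≤ ℓ) {a : ℝ} (ha : 0 < a) :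
    ∃ δ₀ c₀ : ℝ, 0 < δ₀ ∧ 0 < c₀ ∧ ∀ (P : Params) (hPd : P.d = d + 1), P.L = ℓ + 1 →
      ∀ k : ℕ, 1 ≤ k → k ≤ P.K → ∀ (c M0 : Fin (d + 1) → ℕ), (∀ i, 1 ≤ M0 i) →
        (∀ i, c i * P.L ^ k + P.L ^ k * M0 i ≤ P.sitesPerDir 0) → (∀ i, P.L ^ k * M0 i < P.sitesPerDir 0) →
      ∀ (s W : ℕ), 1 ≤ s → ∀ (R R₀ R₁ : ℝ), 1 < R → 0 ≤ R₁ → R₁ < R₀ → 2 * (s : ℝ) / 3 + R₀ / 2 + R ≤ W →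
        (∀ i, ((P.L ^ k * M0 i : ℕ) : ℝ) + R ≤ P.sitesPerDir 0) →
      ∀ (h : GaugeTransf P 0 U1) (x : Balaban1983to89.Site P 0) (μ : Fin P.d),
        x ∈ (cubeT hPd (P.L ^ k) c fun i => P.L ^ k * M0 i) →
        (∀ i, R₀ ≤ (boxCoord hPd (P.L ^ k) c x i : ℝ) ∧ (boxCoord hPd (P.L ^ k) c x i : ℝ) + R₀ ≤ (P.L ^ k * M0 i : ℕ) - 1) →
        x.shift μ ∈ (cubeT hPd (P.L ^ k) c fun i => P.L ^ k * M0 i) →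
        (∀ i, R₀ ≤ (boxCoord hPd (P.L ^ k) c (x.shift μ) i : ℝ) ∧
          (boxCoord hPd (P.L ^ k) c (x.shift μ) i : ℝ) + R₀ ≤ (P.L ^ k * M0 i : ℕ) - 1) →
      ∀ (f : Balaban1983to89.Site P 0 → ℂ) (F D : ℝ), (∀ y, ‖f y‖ ≤ F) → 0 ≤ D → (∀ y, f y ≠ 0 → D ≤ B5Ineq137Torus.T P 0 x y) →
        ‖covD P.eps⁻¹ (cfg (gaugeAct h (1 : GaugeField P 0 U1)))
            (gLocT (B1RG242Torus.α P a k * (P.L : ℝ) ^ (k * P.d)) P.eps⁻¹ (gaugeAct h (1 : GaugeField P 0 U1)) k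
              (cubeFam hPd (P.L ^ k) c M0 s W) (lamFam hPd (P.L ^ k) c M0 s) (cutoff R₁ R₀ (B5Ineq137Torus.T P 0)) *ᵥ f) ⟨x, μ⟩‖ ≤
          P.spacing k * (c₀ * (⌊(((P.L : ℝ) ^ k) - 1 + R₀) / s⌋₊ + 3) ^ (d + 1) *
            (1 + (P.L : ℝ) ^ k * ((R₀ - R₁)⁻¹ + (s : ℝ)⁻¹)) * Real.exp (-(δ₀ * (((P.L : ℝ) ^ k)⁻¹ * D))) * F) := by
  obtain ⟨δ₁, c₁, hδ₁, hc₁, H1⟩ := decay110_flat_cube_deriv_level d ℓ hℓ ha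
  obtain ⟨δ₂, c₂, hδ₂, hc₂, H2⟩ := decay110_flat_cube_level d ℓ hℓ ha
  obtain ⟨K, hK0, hK⟩ := exists_abs_cutoff_sub_le
  -- the constants: rate `min δ₁ δ₂`, prefactor `max c₁ (2c₂·max(K, 3π(d+1)/2))`
  set Λ₀ : ℝ := max K (3 * Real.pi * (d + 1 : ℕ) / 2) with hΛ₀def
  have hΛ₀0 : 0 ≤ Λ₀ := hK0.trans (le_max_left _ _)
  refine ⟨min δ₁ δ₂, max c₁ (2 * c₂ * Λ₀ + 1), lt_min hδ₁ hδ₂, lt_max_of_lt_left hc₁, ?_⟩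
  intro P hPd hPL k hk1 hkK c M0 hM0 hfit0 hN0 s W hs R R₀ R₁ hR hR₁ hR10 hW hgap h x μ hx hdeep hxe hdeepe f F D hF hD hsupp
  set δ := min δ₁ δ₂ with hδdef
  set C := max c₁ (2 * c₂ * Λ₀ + 1) with hCdef
  have hδ1 : δ ≤ δ₁ := min_le_left _ _
  have hδ2 : δ ≤ δ₂ := min_le_right _ _
  have hC1 : c₁ ≤ C := le_max_left _ _
  have hC2 : 2 * c₂ * Λ₀ + 1 ≤ C := le_max_right _ _
  have hC0 : 0 ≤ C := hc₁.le.trans hC1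
  have hn : 1 ≤ P.L ^ k := Nat.one_le_pow _ _ P.L_pos
  have hk : 0 + k ≤ P.m + P.K := by omega
  have hR0 : 0 ≤ R := zero_le_one.trans hR.le
  have hR₀ : 0 ≤ R₀ := hR₁.trans hR10.le
  have hs0 : 0 < s := hs
  have hsr : (0 : ℝ) < s := by exact_mod_cast hs0
  have hgap' : 0 < R₀ - R₁ := sub_pos.2 hR10
  have hLpos : (0 : ℝ) < P.L := P.cast_L_pos
  have hLk : (0 : ℝ) < (P.L : ℝ) ^ k := pow_pos hLpos _
  have hε : 0 < ((P.L : ℝ) ^ k)⁻¹ := inv_pos.mpr hLk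
  have hF0 : 0 ≤ F := (norm_nonneg _).trans (hF x)
  have hsp0 : 0 < P.spacing k := P.spacing_pos k
  have heps : 0 < P.eps := P.eps_pos
  have hζ0 := cutoff_eq_zero_of_le (P := P) hR10
  -- abbreviations
  set Ω₀ : Finset (Balaban1983to89.Site P 0) := cubeT hPd (P.L ^ k) c fun i => P.L ^ k * M0 i with hΩ₀def
  set A : ℝ := B1RG242Torus.α P a k * (P.L : ℝ) ^ (k * P.d) with hAdef
  set U : GaugeField P 0 U1 := gaugeAct h (1 : GaugeField P 0 U1) with hUdef
  set ζ := cutoff R₁ R₀ (B5Ineq137Torus.T P 0) with hζdef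
  set x' := x.shift μ with hx'def
  set m : ℝ := ((⌊(((P.L : ℝ) ^ k) - 1 + R₀) / s⌋₊ : ℝ) + 3) ^ (d + 1) with hmdef
  have hm0 : 0 ≤ m := by rw [hmdef]; positivity
  set E : ℝ := Real.exp (-(δ * (((P.L : ℝ) ^ k)⁻¹ * D))) with hEdef
  have hE0 : 0 < E := Real.exp_pos _
  have hεD : 0 ≤ ((P.L : ℝ) ^ k)⁻¹ * D := mul_nonneg hε.le hD
  have hE1 : Real.exp (-(δ₁ * (((P.L : ℝ) ^ k)⁻¹ * D))) ≤ E := Real.exp_le_exp.2 (by nlinarith)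
  have hE2 : Real.exp (-(δ₂ * (((P.L : ℝ) ^ k)⁻¹ * D))) ≤ E := Real.exp_le_exp.2 (by nlinarith)
  -- the sources
  set g' : ↥(labels (P.L ^ k) M0 s) → Balaban1983to89.Site P 0 → ℂ :=
    fun α y => (ζ x' y : ℂ) * (lamFam hPd (P.L ^ k) c M0 s α x' y : ℂ) * f y with hg'def
  set dg : ↥(labels (P.L ^ k) M0 s) → Balaban1983to89.Site P 0 → ℂ :=
    fun α y => ((ζ x' y : ℂ) * (lamFam hPd (P.L ^ k) c M0 s α x' y : ℂ) - (ζ x y : ℂ) * (lamFam hPd (P.L ^ k) c M0 s α x y : ℂ)) * f y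
    with hdgdef
  -- the identity (sources folded)
  have hid : covD P.eps⁻¹ (cfg U) (gLocT A P.eps⁻¹ U k (cubeFam hPd (P.L ^ k) c M0 s W) (lamFam hPd (P.L ^ k) c M0 s) ζ *ᵥ f) ⟨x, μ⟩ =
      ∑ α, covD P.eps⁻¹ (cfg U) (gBox A P.eps⁻¹ U k (cubeFam hPd (P.L ^ k) c M0 s W α) *ᵥ g' α) ⟨x, μ⟩ +
      ∑ α, ((P.eps⁻¹ : ℝ) : ℂ) * (gBox A P.eps⁻¹ U k (cubeFam hPd (P.L ^ k) c M0 s W α) *ᵥ dg α) x :=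
    covD_gLocT_apply P.eps⁻¹ (cfg U) A P.eps⁻¹ U k (cubeFam hPd (P.L ^ k) c M0 s W) (lamFam hPd (P.L ^ k) c M0 s) ζ f ⟨x, μ⟩
  rw [hid]
  -- the active-label sets of the two endpoints
  set Sx : Finset ↥(labels (P.L ^ k) M0 s) := (activeLabels hPd (P.L ^ k) c s R₀ (blkIter k x)).subtype fun α => α ∈ labels (P.L ^ k) M0 s
    with hSxdef
  set Sx' : Finset ↥(labels (P.L ^ k) M0 s) := (activeLabels hPd (P.L ^ k) c s R₀ (blkIter k x')).subtype fun α => α ∈ labels (P.L ^ k) M0 s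
    with hSx'def
  have hcardx : (Sx.card : ℝ) ≤ m := by
    have h1 := card_subtype_activeLabels_le (hPd := hPd) (c := c) (M0 := M0) hn hs0 hR₀ (blkIter k x)
    have e : (((P.L ^ k : ℕ) : ℕ) : ℝ) = (P.L : ℝ) ^ k := by push_cast; rfl
    rw [hSxdef, hmdef]; rw [e] at h1; exact h1
  have hcardx' : (Sx'.card : ℝ) ≤ m := by
    have h1 := card_subtype_activeLabels_le (hPd := hPd) (c := c) (M0 := M0) hn hs0 hR₀ (blkIter k x')
    have e : (((P.L ^ k : ℕ) : ℕ) : ℝ) = (P.L : ℝ) ^ k := by push_cast; rfl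
    rw [hSx'def, hmdef]; rw [e] at h1; exact h1
  have hSx : ∀ (α : ↥(labels (P.L ^ k) M0 s)) (y : Balaban1983to89.Site P 0),
      ζ x y * lamFam hPd (P.L ^ k) c M0 s α x y ≠ 0 → α ∈ Sx := by
    intro α y hne
    rw [hSxdef, Finset.mem_subtype]
    exact mem_activeLabels_of_ne_zero_of_deep hk hs0 hfit0 hζ0 (mem_blockK_blkIter x) hdeep hne
  have hSx' : ∀ (α : ↥(labels (P.L ^ k) M0 s)) (y : Balaban1983to89.Site P 0),
      ζ x' y * lamFam hPd (P.L ^ k) c M0 s α x' y ≠ 0 → α ∈ Sx' := by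
    intro α y hne
    rw [hSx'def, Finset.mem_subtype]
    exact mem_activeLabels_of_ne_zero_of_deep hk hs0 hfit0 hζ0 (mem_blockK_blkIter x') hdeepe hne
  -- TERM 1: [6]'s derivative member for the cubes active at `x'`
  set B₁ : ℝ := P.spacing k * (c₁ * Real.exp (-(δ₁ * (((P.L : ℝ) ^ k)⁻¹ * D))) * F) with hB₁def
  have hB₁0 : 0 ≤ B₁ := by positivity
  have hterm1 : ∀ α, ‖covD P.eps⁻¹ (cfg U) (gBox A P.eps⁻¹ U k (cubeFam hPd (P.L ^ k) c M0 s W α) *ᵥ g' α) ⟨x, μ⟩‖ ≤ B₁ := by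
    intro α
    by_cases hex : ∃ y, ζ x' y * lamFam hPd (P.L ^ k) c M0 s α x' y ≠ 0
    · obtain ⟨y₀, hy₀⟩ := hex
      -- both endpoints lie in the active cube
      obtain ⟨hx'α, -, hfar⟩ := rowHyp_ii hPd hn hs0 hfit0 hR0 hgap hW hζ0 hxe hdeepe α y₀ hy₀
      have hxα : x ∈ cubeFam hPd (P.L ^ k) c M0 s W α := by
        by_contra hnot
        have h1 := (hfar x hx hnot).1
        have h2 : B5Ineq137Torus.T P 0 x' x ≤ 1 := by
          rw [B5Ineq137Torus.T_symm]; exact T_shift_le_one x μ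
        linarith
      obtain ⟨c', M', hM', hfit', hN', hcα⟩ := cubeFam_fits (hPd := hPd) (s := s) (W := W) hM0 hfit0 hN0 α
      have hcα' : cubeOf hPd (P.L ^ k) c M0 s W α.1 = cubeT hPd (P.L ^ k) c' fun i => P.L ^ k * M' i := hcα
      rw [hcα'] at hx'α
      rw [hcα] at hxα ⊢
      have hζabs : ∀ y, |ζ x' y| ≤ 1 := fun y => by
        rw [hζdef, abs_of_nonneg (cutoff_nonneg _ _ _ _ _)]; exact cutoff_le_one _ _ _ _ _
      refine (H1 P hPd hPL k hk1 hkK c' M' hM' hfit' hN' h x (g' α) F D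
        (fun y => norm_rowSource_le (hζabs y) (abs_lam_le_one (sum_abs_lamT_le_one hfit0) α x' y) hF y)
        (fun y hy => hsupp y (rowSource_ne_zero hy).2) μ hxα hx'α).trans ?_
      exact le_rfl
    · push Not at hex
      have h0 : g' α = 0 := by
        funext y; rw [hg'def]; dsimp only; rw [← Complex.ofReal_mul, hex y, Complex.ofReal_zero, zero_mul]; rfl
      rw [h0, mulVec_zero]
      simp only [covD, Pi.zero_apply, mul_zero, sub_zero, norm_zero]
      exact hB₁0
  have hzero1 : ∀ α, α ∉ Sx' → covD P.eps⁻¹ (cfg U) (gBox A P.eps⁻¹ U k (cubeFam hPd (P.L ^ k) c M0 s W α) *ᵥ g' α) ⟨x, μ⟩ = 0 := by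
    intro α hα
    have h0 : g' α = 0 := by
      funext y
      by_contra hne
      exact hα (hSx' α y (rowSource_ne_zero hne).1)
    rw [h0, mulVec_zero]
    simp only [covD, Pi.zero_apply, mul_zero, sub_zero]
  have hsum1 : ‖∑ α, covD P.eps⁻¹ (cfg U) (gBox A P.eps⁻¹ U k (cubeFam hPd (P.L ^ k) c M0 s W α) *ᵥ g' α) ⟨x, μ⟩‖ ≤ m * B₁ := by
    rw [← Finset.sum_subset (Finset.subset_univ Sx') (fun α _ hα => hzero1 α hα)]
    calc ‖∑ α ∈ Sx', covD P.eps⁻¹ (cfg U) (gBox A P.eps⁻¹ U k (cubeFam hPd (P.L ^ k) c M0 s W α) *ᵥ g' α) ⟨x, μ⟩‖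
        ≤ ∑ α ∈ Sx', ‖covD P.eps⁻¹ (cfg U) (gBox A P.eps⁻¹ U k (cubeFam hPd (P.L ^ k) c M0 s W α) *ᵥ g' α) ⟨x, μ⟩‖ := norm_sum_le _ _
      _ ≤ ∑ α ∈ Sx', B₁ := Finset.sum_le_sum fun α _ => hterm1 α
      _ = Sx'.card * B₁ := by rw [Finset.sum_const, nsmul_eq_mul]
      _ ≤ m * B₁ := mul_le_mul_of_nonneg_right hcardx' hB₁0
  -- TERM 2: [6]'s value member on the difference sources, for the cubes active at `x` or `x'`
  set Λ : ℝ := K / (R₀ - R₁) + 3 * Real.pi * (d + 1 : ℕ) / (2 * s) with hΛdef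
  have hΛ0 : 0 ≤ Λ := by rw [hΛdef]; positivity
  set B₂ : ℝ := P.spacing k ^ 2 * (c₂ * Real.exp (-(δ₂ * (((P.L : ℝ) ^ k)⁻¹ * D))) * (Λ * F)) with hB₂def
  have hB₂0 : 0 ≤ B₂ := by positivity
  have hterm2 : ∀ α, ‖(gBox A P.eps⁻¹ U k (cubeFam hPd (P.L ^ k) c M0 s W α) *ᵥ dg α) x‖ ≤ B₂ := by
    intro α
    obtain ⟨c', M', hM', hfit', hN', hcα⟩ := cubeFam_fits (hPd := hPd) (s := s) (W := W) hM0 hfit0 hN0 α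
    rw [hcα]
    exact H2 P hPd hPL k hk1 hkK c' M' hM' hfit' hN' h x (dg α) (Λ * F) D
      (fun y => norm_rowSource_sub_le hPd hs0 hfit0 hN0 hK0 hR10 (hK R₁ R₀ hR10 (B5Ineq137Torus.T P 0)) α.1 hx hxe hF y)
      (fun y hy => hsupp y (right_ne_zero_of_mul hy))
  have hzero2 : ∀ α, α ∉ Sx ∪ Sx' → (gBox A P.eps⁻¹ U k (cubeFam hPd (P.L ^ k) c M0 s W α) *ᵥ dg α) x = 0 := by
    intro α hα
    rw [Finset.mem_union, not_or] at hα
    have h0 : dg α = 0 := by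
      funext y
      rw [hdgdef]; dsimp only
      have h1 : ζ x' y * lamFam hPd (P.L ^ k) c M0 s α x' y = 0 := by
        by_contra hne; exact hα.2 (hSx' α y hne)
      have h2 : ζ x y * lamFam hPd (P.L ^ k) c M0 s α x y = 0 := by
        by_contra hne; exact hα.1 (hSx α y hne)
      rw [← Complex.ofReal_mul, ← Complex.ofReal_mul, h1, h2]; simp
    rw [h0, mulVec_zero, Pi.zero_apply]
  have hcardU : ((Sx ∪ Sx').card : ℝ) ≤ 2 * m := by
    have h1 : ((Sx ∪ Sx').card : ℝ) ≤ (Sx.card : ℝ) + (Sx'.card : ℝ) := by exact_mod_cast Finset.card_union_le _ _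
    linarith
  have hsum2 : ‖∑ α, ((P.eps⁻¹ : ℝ) : ℂ) * (gBox A P.eps⁻¹ U k (cubeFam hPd (P.L ^ k) c M0 s W α) *ᵥ dg α) x‖ ≤ P.eps⁻¹ * (2 * m * B₂) := by
    rw [← Finset.mul_sum, norm_mul, Complex.norm_real, Real.norm_eq_abs, abs_of_pos (inv_pos.mpr heps)]
    refine mul_le_mul_of_nonneg_left ?_ (inv_pos.mpr heps).le
    rw [← Finset.sum_subset (Finset.subset_univ (Sx ∪ Sx')) (fun α _ hα => hzero2 α hα)]
    calc ‖∑ α ∈ Sx ∪ Sx', (gBox A P.eps⁻¹ U k (cubeFam hPd (P.L ^ k) c M0 s W α) *ᵥ dg α) x‖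
        ≤ ∑ α ∈ Sx ∪ Sx', ‖(gBox A P.eps⁻¹ U k (cubeFam hPd (P.L ^ k) c M0 s W α) *ᵥ dg α) x‖ := norm_sum_le _ _
      _ ≤ ∑ α ∈ Sx ∪ Sx', B₂ := Finset.sum_le_sum fun α _ => hterm2 α
      _ = (Sx ∪ Sx').card * B₂ := by rw [Finset.sum_const, nsmul_eq_mul]
      _ ≤ 2 * m * B₂ := mul_le_mul_of_nonneg_right hcardU hB₂0
  -- assembling: `m·B₁ + ε⁻¹·2m·B₂ ≤ (L^kε)·C·m·(1 + L^k((R₀−R₁)⁻¹ + s⁻¹))·E·F`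
  have hscale : P.eps⁻¹ * P.spacing k ^ 2 = P.spacing k * (P.L : ℝ) ^ k := by
    rw [Params.spacing]
    field_simp
  have hΛle : Λ ≤ Λ₀ * ((R₀ - R₁)⁻¹ + (s : ℝ)⁻¹) := by
    rw [hΛdef, mul_add]
    refine add_le_add ?_ ?_
    · rw [div_eq_mul_inv]
      exact mul_le_mul_of_nonneg_right (le_max_left _ _) (inv_pos.mpr hgap').le
    · have e : 3 * Real.pi * (d + 1 : ℕ) / (2 * s) = (3 * Real.pi * (d + 1 : ℕ) / 2) * (s : ℝ)⁻¹ := by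
        field_simp
      rw [e]
      exact mul_le_mul_of_nonneg_right (le_max_right _ _) (inv_pos.mpr hsr).le
  have h1 : m * B₁ ≤ P.spacing k * (C * m * 1 * E * F) := by
    have : B₁ ≤ P.spacing k * (C * E * F) := by
      rw [hB₁def]
      refine mul_le_mul_of_nonneg_left ?_ hsp0.le
      exact mul_le_mul_of_nonneg_right (mul_le_mul hC1 hE1 (Real.exp_pos _).le hC0) hF0
    calc m * B₁ ≤ m * (P.spacing k * (C * E * F)) := mul_le_mul_of_nonneg_left this hm0
      _ = P.spacing k * (C * m * 1 * E * F) := by ring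
  have h2 : P.eps⁻¹ * (2 * m * B₂) ≤ P.spacing k * (C * m * ((P.L : ℝ) ^ k * ((R₀ - R₁)⁻¹ + (s : ℝ)⁻¹)) * E * F) := by
    have e : P.eps⁻¹ * (2 * m * B₂) =
        P.spacing k * ((2 * c₂ * Λ) * m * (P.L : ℝ) ^ k * Real.exp (-(δ₂ * (((P.L : ℝ) ^ k)⁻¹ * D))) * F) := by
      rw [hB₂def]
      have : P.eps⁻¹ * (2 * m * (P.spacing k ^ 2 * (c₂ * Real.exp (-(δ₂ * (((P.L : ℝ) ^ k)⁻¹ * D))) * (Λ * F)))) =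
          (P.eps⁻¹ * P.spacing k ^ 2) * (2 * c₂ * Λ * m * Real.exp (-(δ₂ * (((P.L : ℝ) ^ k)⁻¹ * D))) * F) := by ring
      rw [this, hscale]; ring
    rw [e]
    refine mul_le_mul_of_nonneg_left ?_ hsp0.le
    have hcoef : 2 * c₂ * Λ * m * (P.L : ℝ) ^ k ≤ C * m * ((P.L : ℝ) ^ k * ((R₀ - R₁)⁻¹ + (s : ℝ)⁻¹)) := by
      have h3 : 2 * c₂ * Λ ≤ C * ((R₀ - R₁)⁻¹ + (s : ℝ)⁻¹) := by
        calc 2 * c₂ * Λ ≤ 2 * c₂ * (Λ₀ * ((R₀ - R₁)⁻¹ + (s : ℝ)⁻¹)) := mul_le_mul_of_nonneg_left hΛle (by positivity)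
          _ = (2 * c₂ * Λ₀) * ((R₀ - R₁)⁻¹ + (s : ℝ)⁻¹) := by ring
          _ ≤ C * ((R₀ - R₁)⁻¹ + (s : ℝ)⁻¹) :=
              mul_le_mul_of_nonneg_right (by linarith) (by positivity)
      calc 2 * c₂ * Λ * m * (P.L : ℝ) ^ k = (2 * c₂ * Λ) * (m * (P.L : ℝ) ^ k) := by ring
        _ ≤ (C * ((R₀ - R₁)⁻¹ + (s : ℝ)⁻¹)) * (m * (P.L : ℝ) ^ k) := mul_le_mul_of_nonneg_right h3 (by positivity)
        _ = C * m * ((P.L : ℝ) ^ k * ((R₀ - R₁)⁻¹ + (s : ℝ)⁻¹)) := by ring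
    exact mul_le_mul_of_nonneg_right (mul_le_mul hcoef hE2 (Real.exp_pos _).le (by positivity)) hF0
  refine ((norm_add_le _ _).trans (add_le_add hsum1 hsum2)).trans ?_
  calc m * B₁ + P.eps⁻¹ * (2 * m * B₂)
      ≤ P.spacing k * (C * m * 1 * E * F) + P.spacing k * (C * m * ((P.L : ℝ) ^ k * ((R₀ - R₁)⁻¹ + (s : ℝ)⁻¹)) * E * F) :=
        add_le_add h1 h2
    _ = P.spacing k * (C * m * (1 + (P.L : ℝ) ^ k * ((R₀ - R₁)⁻¹ + (s : ℝ)⁻¹)) * E * F) := by ring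

end Deriv

end

end Literature.MathematicalPhysics.QuantumFieldTheory.BalabanImbrieJaffe1984to88.BIJ88LocDeriv230FlatTorus
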